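import Literature.NumberTheory.GaloisRepresentations.WeilLAdicCharacterProofs
import Literature.NumberTheory.GaloisRepresentations.HeckeCharacterOfGrossencharakter
import HarnessLib

/-!
# Route `SignedLowerHalves`, crux L `SmallImageLowerHalfBothSigns` (item stmt-BirchSwinnertonDyer-23599), line `rtt_w3` —
# brick JD-a of the character road: the `p`-adic character of a Grössencharakter PINNED BY `θ(Frob_w^{arith}) = e⁻¹(ψ(w))`

LEAD `cruxlead-stmt-BirchSwinnertonDyer-23599` g5; helper `--supports stmt-BirchSwinnertonDyer-23599`; THEOREMS ONLY, no `sorry`; closes nothing;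
BSD / crux L are not proved by this.

WHY. The v8 cut of the line's research stub (`stub_charRoad_ns = JD ∧ E1 ∧ E2`, glue `SmallImageRttCharRoad.psbTheta_of_charRoad`) pins the
character `θ = ψ_𝔭 : Γ_K → 𝒪ˣ` of the theta partner's Grössencharakter `ψ` by the ARITHMETIC-Frobenius clause
`θ.HasFrobCharpolyAt w (X − C (e⁻¹(ψ w)))` — the convention forced by the Tate module of `W` (`X² − a_v X + q_v` at arithmetic Frobenius) and the
congruence `a_ℓ(W) ≡ ψ(w) + ψ(w̄)`, `ℓ = ψ(w)ψ(w̄)` (memo `Lines/rtt_w3-BRIEF-v8-g5.md` §1). Weil's theorem as packaged in the tree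
(`exists_galoisCharacter_of_isGrossencharakter`) produces `X − C (ι⁻¹(ψ v)⁻¹)`; applied to the INVERSE Grössencharakter `ψ⁻¹`
(`IsGrossencharakter.inv`) it gives exactly the pinned character. This file records that two-line deduction (the rational half of JD; the integral
framing over `𝒪_{ℚ_p(S)}` and the local splitting `j` above `p` are the remaining content of JD).

References: [Weil1956] §1; [NeukirchANT1999] Ch. VII §6 Cor. (6.14).
-/

set_option autoImplicit false
-- D-0017: single-problem summit, the namespace repeats the problem name by design.
set_option linter.dupNamespace false
noncomputable section

open scoped NumberField
open NumberField IsDedekindDomain Polynomial Field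
  Literature.NumberTheory.GaloisRepresentations Literature.NumberTheory.LFunctions

namespace Summit.BirchSwinnertonDyer.BirchSwinnertonDyer.Theorems.SmallImageRttCharRoad

/-- **JD-a: the pinned `ℓ`-adic character of a Grössencharakter.** For a Grössencharakter `ψ mod 𝔪` (`𝔪 ≠ 0`, infinity type `(a, b)`) of a number
field `K`, a prime `ℓ` and `e : ℚ̄_ℓ ≃ ℂ`, there is a continuous character `r : Γ_K → GL₁(ℚ̄_ℓ)` which at every `v ∤ ℓ` with `𝔪 ≰ v` is unramified
with arithmetic-Frobenius characteristic polynomial `X − e⁻¹(ψ(v))` — Weil's character of `ψ⁻¹` (`exists_galoisCharacter_of_isGrossencharakter`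
∘ the inverse Grössencharakter `ψ⁻¹` of type `(-a,-b)`, `inv_inv`; both steps PROVED in the tree:
`HeckeCharacter.exists_of_isGrossencharakter`, `HeckeCharacter.IsAlgebraic.exists_lAdic`). [cite: Weil1956, §1] [cite: NeukirchANT1999, Ch. VII §6 Cor. (6.14)] -/
theorem exists_pinnedCharacter_of_isGrossencharakter {K : Type} [Field K] [NumberField K] {𝔪 : Ideal (𝓞 K)}
    (h𝔪 : 𝔪 ≠ ⊥) {a b : InfinitePlace K → ℤ} {ψ : HeightOneSpectrum (𝓞 K) → ℂ} (hψ : IsGrossencharakter 𝔪 a b ψ)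
    {ℓ : ℕ} [Fact ℓ.Prime] (e : PadicAlgCl ℓ ≃+* ℂ) :
    ∃ r : FramedGaloisRep K (PadicAlgCl ℓ) 1, ∀ v : HeightOneSpectrum (𝓞 K),
      ((ℓ : ℕ) : 𝓞 K) ∉ v.asIdeal → ¬ 𝔪 ≤ v.asIdeal →
        r.IsUnramifiedAt v ∧ r.HasFrobCharpolyAt v (X - C (e.symm (ψ v))) := by
  -- `ψ⁻¹` is a Grössencharakter mod `𝔪` of type `(-a, -b)` (as `IsGrossencharakter.inv` of `Automorphic/ReducibleGaloisRepOfCharacters`)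
  have hpow : ∀ I : Ideal (𝓞 K), idealPow K (fun v => (ψ v)⁻¹) I = (idealPow K ψ I)⁻¹ := fun I => by
    rw [idealPow, idealPow, ← finprod_inv_distrib]
    exact finprod_congr fun v => inv_pow _ _
  have hinv : IsGrossencharakter 𝔪 (fun w => -a w) (fun w => -b w) (fun v => (ψ v)⁻¹) := by
    refine ⟨fun v hv => inv_ne_zero (hψ.ne_zero v hv), fun c d hc hd hcop hcd hpos => ?_⟩
    rw [hpow, hpow, hψ.idealPow_span_eq c d hc hd hcop hcd hpos, mul_inv, ← Finset.prod_inv_distrib]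
    refine congrArg _ (Finset.prod_congr rfl fun w _ => ?_)
    rw [mul_inv, zpow_neg, zpow_neg]
  -- Weil's character of `ψ⁻¹` (Neukirch VII (6.14): the idelic lift; Weil 1956: the `ℓ`-adic character)
  obtain ⟨ω, hωpq, hω⟩ := HeckeCharacter.exists_of_isGrossencharakter h𝔪 hinv
  have halg : ω.IsAlgebraic := ω.isAlgebraic_iff_exists_hasInfinityType.2 ⟨_, _, hωpq⟩
  obtain ⟨r, hr⟩ := halg.exists_lAdic e
  refine ⟨r, fun v hvℓ hv => ?_⟩
  obtain ⟨hunr, hval⟩ := hω v hv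
  obtain ⟨h1, h2⟩ := hr v hvℓ hunr
  rw [hval] at h2
  exact ⟨h1, by simpa only [inv_inv] using h2⟩

/-- **The other convention, for contrast**: Weil's character of `ψ` ITSELF is pinned by `X − C ((e⁻¹(ψ v))⁻¹)` (`map_inv₀`); over `G_K` this is
`θ^c ⊗ χ_cyc⁻¹` for the road's `θ`, NOT the character the transport `j` of JD can exist for (memo §1). [cite: Weil1956, §1] -/
theorem exists_invPinnedCharacter_of_isGrossencharakter {K : Type} [Field K] [NumberField K] {𝔪 : Ideal (𝓞 K)}
    (h𝔪 : 𝔪 ≠ ⊥) {a b : InfinitePlace K → ℤ} {ψ : HeightOneSpectrum (𝓞 K) → ℂ} (hψ : IsGrossencharakter 𝔪 a b ψ)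
    {ℓ : ℕ} [Fact ℓ.Prime] (e : PadicAlgCl ℓ ≃+* ℂ) :
    ∃ r : FramedGaloisRep K (PadicAlgCl ℓ) 1, ∀ v : HeightOneSpectrum (𝓞 K),
      ((ℓ : ℕ) : 𝓞 K) ∉ v.asIdeal → ¬ 𝔪 ≤ v.asIdeal →
        r.IsUnramifiedAt v ∧ r.HasFrobCharpolyAt v (X - C ((e.symm (ψ v))⁻¹)) := by
  obtain ⟨ω, hωpq, hω⟩ := HeckeCharacter.exists_of_isGrossencharakter h𝔪 hψ
  have halg : ω.IsAlgebraic := ω.isAlgebraic_iff_exists_hasInfinityType.2 ⟨_, _, hωpq⟩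
  obtain ⟨r, hr⟩ := halg.exists_lAdic e
  refine ⟨r, fun v hvℓ hv => ?_⟩
  obtain ⟨hunr, hval⟩ := hω v hv
  obtain ⟨h1, h2⟩ := hr v hvℓ hunr
  rw [hval] at h2
  exact ⟨h1, by simpa only [map_inv₀] using h2⟩

end Summit.BirchSwinnertonDyer.BirchSwinnertonDyer.Theorems.SmallImageRttCharRoad

end
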